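import Summits.BirchSwinnertonDyer.BirchSwinnertonDyer.Theorems.SignedLowerHalvesSmallImageLowerHalfBothSignsRttJunctionLambdaLocImage
import HarnessLib

/-!
# Route `SignedLowerHalves`, crux L `SmallImageLowerHalfBothSigns` (stmt-BirchSwinnertonDyer-23599), line `rtt_w3` v22 → v23 — stub S3β (row J4′, Poitou–Tate half):
# ★★ `λ(coker gX) = λ(Y′) + λ((Sel_{str,v} ⧸ Sel_{str})^∨)` and the reduction S3β ⟸ S3β″ «`λ(Λ_𝒪/(E)) ≤ λ((Sel_{str,v} ⧸ Sel_{str})^∨) + λ(I.H ⧸ B′)`»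

Stub hand `bsd-inputs-lambda-p1` g0 under LEAD `cruxlead-stmt-BirchSwinnertonDyer-23599` g12/g13 (cell `bsd-ssimc`); helper `--supports stmt-BirchSwinnertonDyer-23599`.
THEOREMS ONLY (no definition, no named fact, no instance, no `sorry`). HONEST FRAMING: `Λ`-bookkeeping on the A-side of the four-term sequence
(`λ(Y) = λ(Y′) + λ(range-of-localisation^∨)` is the Pontryagin-exactness part of p784625's identity `λ(Y) + λ(B/B′) = λ(Y′) + λ(Hloc)`); what is LEFT of S3β after this file is
S3β″: `λ(Λ_𝒪/(E)) ≤ λ((Sel_{str,v} ⧸ Sel_{str})^∨) + λ(I.H ⧸ B′)` — Poitou–Tate at `S₀K` in the tower (`im(loc^{T*}) = ann(im loc^{A})` in `Hloc`) + the local count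
`λ(Λ_𝒪/(E)) ≤ λ(Hloc)`; no `gX`, no `DQ`, no pinned `Λ_𝒪`-structures occur in it. Crux L / E2 / S3 / BSD remain OPEN and are proved for NO curve.

* `isTorsion_of_surjective_linearMap`, ★★ `lambdaInvariant_coker_eq_strictDual_add_locImageDual` (`Λ`-currency: `coker gX ≅ Sel_{str,v}^∨` by `ker res = range gX` + first
  isomorphism theorem; `λ(Sel_{str,v}^∨) = λ(ker res_v) + λ(Y′)` by additivity; `ker res_v ≅ (Sel_{str,v}/Sel_str)^∨` by `infl`),
* ★★ `lambdaInvariant_coker_eq_strictDual_add_locImageDual_O` (the stub's `Λ_𝒪`-currency `gXLinearMapO`, any pinned `instX/instQ`; `Submodule.Quotient.restrictScalarsEquiv`),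
* ★★ `strictDual_add_le_coker_add_of_le_locImageDual_add` — S3β's inequality `e + λ(Y′) ≤ λ(Dψ.X ⧸ range gX) + q` from S3β″'s `e ≤ λ((Sel_{str,v}/Sel_str)^∨) + q`.
References: [Kobayashi2003] Thm. 7.3 i); [Rubin2000] Thm. 1.7.3; [Washington1997] §13.2; [NeukirchSchmidtWingberg2008] (8.6.10).
-/

set_option autoImplicit false
set_option linter.dupNamespace false -- D-0017: single-problem summit, the namespace repeats the problem name by design
noncomputable section

open scoped Classical
open NumberField IsDedekindDomain Field

universe u

namespace Summit.BirchSwinnertonDyer.BirchSwinnertonDyer.Theorems.SmallImageRttD2Seq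

open Literature.NumberTheory.EllipticCurves Literature.NumberTheory.EllipticCurves.Kobayashi2003
  Literature.NumberTheory.EllipticCurves.GreenbergVatsal2000 Literature.NumberTheory.GaloisRepresentations
  Summit.BirchSwinnertonDyer.BirchSwinnertonDyer.Theorems.SmallImageCharSignedSelmer
open Summit.BirchSwinnertonDyer.Rank1Residual.X2.DualRestrictionInvariants (lambdaInvariant_eq_add_of_surjective)

/-! ## §4. ★★ The λ-split of `coker gX` -/

section LambdaSplit

variable {K : Type u} [Field K] [NumberField K] {p : ℕ} [Fact p.Prime] {κ : ZpExtension K p} {γ : absoluteGaloisGroup K}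
  {M : Type u} [AddCommGroup M] [DistribMulAction (absoluteGaloisGroup K) M] [TopologicalSpace M] [DiscreteTopology M]
  {R : Type*} [Ring R] [Module R M] {V : WeierstrassCurve K} {j : V.geomPrimaryTorsion p →+ M} {S₀ : Set (HeightOneSpectrum (𝓞 K))} {ε : ℤˣ}
  (D : SignedTransportDualDataSat κ γ M R V j S₀ ε) {v : HeightOneSpectrum (𝓞 K)} [DistribMulAction (absoluteGaloisGroup (v.adicCompletion K)) M]
  {γv : absoluteGaloisGroup (v.adicCompletion K)} (DQ : LocalCondDualData κ M R V j ε v γv)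
  (hres : ∀ (σ : absoluteGaloisGroup (v.adicCompletion K)) (m : M), σ • m = resGalOfEmb (closureEmb (K := K) (v.adicCompletion K)) σ • m)
  (hv : (p : 𝓞 K) ∈ v.asIdeal) (S₁ : Set (HeightOneSpectrum (𝓞 K))) (hle : strictSelmer κ M R V j S₀ ε S₁ ≤ strictAt κ M R V j S₀ ε v hres hv)
  (hns : AcSigned.IsNonsplitIn κ v) (htor : ∀ m : M, ∃ k : ℕ, p ^ k • m = 0)
  (hstabK : ∀ m : M, IsOpen (MulAction.stabilizer (absoluteGaloisGroup K) m : Set (absoluteGaloisGroup K)))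
  (hstab : ∀ m : M, IsOpen (MulAction.stabilizer (absoluteGaloisGroup (v.adicCompletion K)) m : Set (absoluteGaloisGroup (v.adicCompletion K))))
  (hγ : κ.IsTopGenerator γ) (hγv : κ.IsTopGenerator (resGalOfEmb (closureEmb (K := K) (v.adicCompletion K)) γv))

include hle

omit hle in
/-- The image of a torsion `Λ`-module under a surjective `Λ`-linear map is torsion. [folklore] -/
theorem isTorsion_of_surjective_linearMap {X : Type*} {Y : Type*} [AddCommGroup X] [Module (IwasawaAlgebra p) X] [AddCommGroup Y] [Module (IwasawaAlgebra p) Y]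
    (f : X →ₗ[IwasawaAlgebra p] Y) (hf : Function.Surjective f) (hX : Module.IsTorsion (IwasawaAlgebra p) X) : Module.IsTorsion (IwasawaAlgebra p) Y := by
  intro y
  obtain ⟨x, rfl⟩ := hf y
  obtain ⟨a, ha⟩ := @hX x
  exact ⟨a, by change (a : IwasawaAlgebra p) • f x = 0; rw [← map_smul, show (a : IwasawaAlgebra p) • x = 0 from ha, map_zero]⟩

/-- ★★ **`λ(coker gX) = λ(Y′) + λ((Sel_{str,v} ⧸ Sel_{str})^∨)`** (`Λ`-currency) for `Dψ.X` finitely generated torsion: `coker gX ≅ Sel_{str,v}^∨` (`ker res = range gX`, first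
isomorphism theorem), `λ(Sel_{str,v}^∨) = λ(ker res_v) + λ(Y′)` (additivity along the surjection `res_v`), `ker res_v = range infl ≅ (Sel_{str,v}/Sel_str)^∨` (`infl` injective).
The Pontryagin-exactness part of the four-term identity of S3β. [cite: Washington1997, §13.2] [cite: Rubin2000, Thm. 1.7.3] -/
theorem lambdaInvariant_coker_eq_strictDual_add_locImageDual [Module.Finite (IwasawaAlgebra p) D.X] (hX : Module.IsTorsion (IwasawaAlgebra p) D.X) :
    letI := strictDualModule κ R V j S₀ ε S₁ htor hstabK hγ; letI := locImageDualModule κ R V j S₀ ε v hres hv S₁ hns htor hstabK hγ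
    lambdaInvariant p (D.X ⧸ LinearMap.range (gXLinearMap D DQ hres hv htor hstabK hstab hγ hns hγv)) =
      lambdaInvariant p (strictSelmer κ M R V j S₀ ε S₁ →+ AddCircle (1 : ℚ)) + lambdaInvariant p (locImageQuot κ M R V j S₀ ε v hres hv S₁ →+ AddCircle (1 : ℚ)) := by
  letI := strictAtDualModule κ R V j S₀ ε v hres hv hns htor hstabK hγ; letI := strictDualModule κ R V j S₀ ε S₁ htor hstabK hγ
  letI := locImageDualModule κ R V j S₀ ε v hres hv S₁ hns htor hstabK hγ
  haveI : Module.Finite (IwasawaAlgebra p) (strictAt κ M R V j S₀ ε v hres hv →+ AddCircle (1 : ℚ)) :=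
    Module.Finite.of_surjective (resAtLinearMap D hres hv hns htor hstabK hγ) (resAtLinearMap_surjective D hres hv hns htor hstabK hγ)
  have hA : Module.IsTorsion (IwasawaAlgebra p) (strictAt κ M R V j S₀ ε v hres hv →+ AddCircle (1 : ℚ)) :=
    isTorsion_of_surjective_linearMap (resAtLinearMap D hres hv hns htor hstabK hγ) (resAtLinearMap_surjective D hres hv hns htor hstabK hγ) hX
  have e1 : (D.X ⧸ LinearMap.range (gXLinearMap D DQ hres hv htor hstabK hstab hγ hns hγv)) ≃ₗ[IwasawaAlgebra p]
      (strictAt κ M R V j S₀ ε v hres hv →+ AddCircle (1 : ℚ)) :=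
    (Submodule.quotEquivOfEq _ _ (ker_resAt_eq_range_gX D DQ hres hv hns htor hstabK hstab hγ hγv).symm).trans
      ((resAtLinearMap D hres hv hns htor hstabK hγ).quotKerEquivOfSurjective (resAtLinearMap_surjective D hres hv hns htor hstabK hγ))
  have h2 := lambdaInvariant_eq_add_of_surjective p (resToStrictLinearMap hres hv S₁ hle hns htor hstabK hγ (M := M)) hA
    (resToStrictLinearMap_surjective hres hv S₁ hle hns htor hstabK hγ)
  have e3 : LinearMap.ker (resToStrictLinearMap hres hv S₁ hle hns htor hstabK hγ (M := M)) ≃ₗ[IwasawaAlgebra p]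
      (locImageQuot κ M R V j S₀ ε v hres hv S₁ →+ AddCircle (1 : ℚ)) :=
    (LinearEquiv.ofEq _ _ (ker_resToStrict_eq_range_infl hres hv S₁ hle hns htor hstabK hγ)).trans
      (LinearEquiv.ofInjective _ (inflLinearMap_injective hres hv S₁ hns htor hstabK hγ)).symm
  rw [lambdaInvariant_eq_of_linearEquiv e1, h2, lambdaInvariant_eq_of_linearEquiv e3, add_comm]

end LambdaSplit

/-! ## §5. The same in the stub's `Λ_𝒪`-currency, and S3β ⟸ S3β″ -/

section LambdaSplitO

variable {K : Type u} [Field K] [NumberField K] {p : ℕ} [Fact p.Prime] {κ : ZpExtension K p} {γ : absoluteGaloisGroup K}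
  (S : Set (PadicAlgCl p)) [FiniteDimensional ℚ_[p] (padicCoeffField S)]
  {M : Type u} [AddCommGroup M] [DistribMulAction (absoluteGaloisGroup K) M] [TopologicalSpace M] [DiscreteTopology M]
  [Module (padicCoeffIntegers S) M] [SMulCommClass (absoluteGaloisGroup K) (padicCoeffIntegers S) M]
  {V : WeierstrassCurve K} {j : V.geomPrimaryTorsion p →+ M} {S₀ : Set (HeightOneSpectrum (𝓞 K))} {ε : ℤˣ}
  (D : SignedTransportDualDataSat κ γ M (padicCoeffIntegers S) V j S₀ ε) {v : HeightOneSpectrum (𝓞 K)} [DistribMulAction (absoluteGaloisGroup (v.adicCompletion K)) M]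
  [SMulCommClass (absoluteGaloisGroup (v.adicCompletion K)) (padicCoeffIntegers S) M]
  {γv : absoluteGaloisGroup (v.adicCompletion K)} (DQ : LocalCondDualData κ M (padicCoeffIntegers S) V j ε v γv)
  (hres : ∀ (σ : absoluteGaloisGroup (v.adicCompletion K)) (m : M), σ • m = resGalOfEmb (closureEmb (K := K) (v.adicCompletion K)) σ • m)
  (hv : (p : 𝓞 K) ∈ v.asIdeal) (S₁ : Set (HeightOneSpectrum (𝓞 K)))
  (hle : strictSelmer κ M (padicCoeffIntegers S) V j S₀ ε S₁ ≤ strictAt κ M (padicCoeffIntegers S) V j S₀ ε v hres hv)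
  (instX : Module (IwasawaAlgebraO S) D.X) (instQ : Module (IwasawaAlgebraO S) DQ.X)
  (hιX : ∀ (f : IwasawaAlgebra p) (x : D.X), (letI := instX; iwasawaToIwasawaO S f • x) = f • x)
  (hιQ : ∀ (f : IwasawaAlgebra p) (x : DQ.X), (letI := instQ; iwasawaToIwasawaO S f • x) = f • x)
  (hCX : ∀ (a : padicCoeffIntegers S) (x : D.X) (s : signedTransportSelmerInftySat κ M (padicCoeffIntegers S) V j S₀ ε),
    D.toDual (letI := instX; (PowerSeries.C a : IwasawaAlgebraO S) • x) s =
      D.toDual x ⟨GreenbergSelmer.scalarH1 κ.kerSubgroup M a s, scalarH1_mem_signedTransportSelmerInftySat κ M (padicCoeffIntegers S) V j S₀ ε a s.2⟩)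
  (hCQ : ∀ (a : padicCoeffIntegers S) (x : DQ.X) (c : localCondInftySat κ M (padicCoeffIntegers S) V j ε v),
    DQ.toDual (letI := instQ; (PowerSeries.C a : IwasawaAlgebraO S) • x) c = DQ.toDual x (scalarLocalSat κ M (padicCoeffIntegers S) V j ε v a c))
  (hns : AcSigned.IsNonsplitIn κ v) (htor : ∀ m : M, ∃ k : ℕ, p ^ k • m = 0)
  (hstabK : ∀ m : M, IsOpen (MulAction.stabilizer (absoluteGaloisGroup K) m : Set (absoluteGaloisGroup K)))
  (hstab : ∀ m : M, IsOpen (MulAction.stabilizer (absoluteGaloisGroup (v.adicCompletion K)) m : Set (absoluteGaloisGroup (v.adicCompletion K))))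
  (hγ : κ.IsTopGenerator γ) (hγv : κ.IsTopGenerator (resGalOfEmb (closureEmb (K := K) (v.adicCompletion K)) γv))

include hle

/-- ★★ **`λ(Dψ.X ⧸ range gX) = λ(Y′) + λ((Sel_{str,v} ⧸ Sel_{str})^∨)` in the stub's `Λ_𝒪`-currency** (`gX := gXLinearMapO …`, quotient `Λ`-structure through the scalar
tower, as in `CharRoadLambda`). [cite: Washington1997, §13.2] [cite: Rubin2000, Thm. 1.7.3] -/
theorem lambdaInvariant_coker_eq_strictDual_add_locImageDual_O [Module.Finite (IwasawaAlgebra p) D.X] (hX : Module.IsTorsion (IwasawaAlgebra p) D.X) :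
    letI := instX; letI := instQ
    letI : Algebra (IwasawaAlgebra p) (IwasawaAlgebraO S) := (iwasawaToIwasawaO S).toAlgebra
    haveI : IsScalarTower (IwasawaAlgebra p) (IwasawaAlgebraO S) D.X := SmallImageRttCharRoad.isScalarTower_iwasawaAlgebraO_of_smul_eq S (fun _ ↦ rfl) hιX
    letI := strictDualModule κ (padicCoeffIntegers S) V j S₀ ε S₁ htor hstabK hγ
    letI := locImageDualModule κ (padicCoeffIntegers S) V j S₀ ε v hres hv S₁ hns htor hstabK hγ
    lambdaInvariant p (D.X ⧸ LinearMap.range (gXLinearMapO S D DQ hres hv instX instQ hιX hιQ hCX hCQ htor hstabK hstab hγ hns hγv)) =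
      lambdaInvariant p (strictSelmer κ M (padicCoeffIntegers S) V j S₀ ε S₁ →+ AddCircle (1 : ℚ)) +
        lambdaInvariant p (locImageQuot κ M (padicCoeffIntegers S) V j S₀ ε v hres hv S₁ →+ AddCircle (1 : ℚ)) := by
  letI := instX; letI := instQ
  letI : Algebra (IwasawaAlgebra p) (IwasawaAlgebraO S) := (iwasawaToIwasawaO S).toAlgebra
  haveI : IsScalarTower (IwasawaAlgebra p) (IwasawaAlgebraO S) D.X := SmallImageRttCharRoad.isScalarTower_iwasawaAlgebraO_of_smul_eq S (fun _ ↦ rfl) hιX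
  letI := strictDualModule κ (padicCoeffIntegers S) V j S₀ ε S₁ htor hstabK hγ
  letI := locImageDualModule κ (padicCoeffIntegers S) V j S₀ ε v hres hv S₁ hns htor hstabK hγ
  have heq : (LinearMap.range (gXLinearMapO S D DQ hres hv instX instQ hιX hιQ hCX hCQ htor hstabK hstab hγ hns hγv)).restrictScalars (IwasawaAlgebra p) =
      LinearMap.range (gXLinearMap D DQ hres hv htor hstabK hstab hγ hns hγv) := by
    ext x
    simp only [Submodule.restrictScalars_mem, LinearMap.mem_range, gXLinearMapO_apply, gXLinearMap_apply]
  rw [lambdaInvariant_eq_of_linearEquiv ((Submodule.Quotient.restrictScalarsEquiv (IwasawaAlgebra p)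
    (LinearMap.range (gXLinearMapO S D DQ hres hv instX instQ hιX hιQ hCX hCQ htor hstabK hstab hγ hns hγv))).symm.trans (Submodule.quotEquivOfEq _ _ heq))]
  exact lambdaInvariant_coker_eq_strictDual_add_locImageDual D DQ hres hv S₁ hle hns htor hstabK hstab hγ hγv hX

/-- ★★ **S3β ⟸ S3β″ (pointwise, in the stub's currency).** If `e ≤ λ((Sel_{str,v} ⧸ Sel_{str})^∨) + q` (S3β″ with `e := λ(Λ_𝒪/(E))`, `q := λ(I.H ⧸ B′)`: Poitou–Tate at
`S₀K` + the local count), then `e + λ(Y′) ≤ λ(Dψ.X ⧸ range gX) + q` — the inequality `CharRoadLambda … (λ(Y′)) 𝔣 I E` of S3β for the given local data.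
[cite: Kobayashi2003, Thm. 7.3 i)] [cite: Rubin2000, Thm. 1.7.3] -/
theorem strictDual_add_le_coker_add_of_le_locImageDual_add [Module.Finite (IwasawaAlgebra p) D.X] (hX : Module.IsTorsion (IwasawaAlgebra p) D.X) {e q : ℕ}
    (h : letI := locImageDualModule κ (padicCoeffIntegers S) V j S₀ ε v hres hv S₁ hns htor hstabK hγ
      e ≤ lambdaInvariant p (locImageQuot κ M (padicCoeffIntegers S) V j S₀ ε v hres hv S₁ →+ AddCircle (1 : ℚ)) + q) :
    letI := instX; letI := instQ
    letI : Algebra (IwasawaAlgebra p) (IwasawaAlgebraO S) := (iwasawaToIwasawaO S).toAlgebra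
    haveI : IsScalarTower (IwasawaAlgebra p) (IwasawaAlgebraO S) D.X := SmallImageRttCharRoad.isScalarTower_iwasawaAlgebraO_of_smul_eq S (fun _ ↦ rfl) hιX
    letI := strictDualModule κ (padicCoeffIntegers S) V j S₀ ε S₁ htor hstabK hγ
    e + lambdaInvariant p (strictSelmer κ M (padicCoeffIntegers S) V j S₀ ε S₁ →+ AddCircle (1 : ℚ)) ≤
      lambdaInvariant p (D.X ⧸ LinearMap.range (gXLinearMapO S D DQ hres hv instX instQ hιX hιQ hCX hCQ htor hstabK hstab hγ hns hγv)) + q := by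
  have hsplit := lambdaInvariant_coker_eq_strictDual_add_locImageDual_O S D DQ hres hv S₁ hle instX instQ hιX hιQ hCX hCQ hns htor hstabK hstab hγ hγv hX
  rw [hsplit]
  omega

end LambdaSplitO

end Summit.BirchSwinnertonDyer.BirchSwinnertonDyer.Theorems.SmallImageRttD2Seq

end
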